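/-
Copyright (c) 2026 the pub-hodgecm-mathlib formalisation cell (harness21).  Prover seat hodgecm-mathlib-K2Liu-p03 (g7): Track B «K2-LIT», hLiu418 = stmt-HodgeConjecture-24832,
road `K2_Liu`, #41 (β) Euler face, brick (E6) FILE 1 (LEAD BATCH #53 (1); K2Liu-p13 (g4) desk «=» 16:33:47Z): THE IWASAWA HEIGHT FACTORS OVER THE PLACES ON A SLICE.
-/
import Summits.HodgeConjecture.HodgeConjecture.Theorems.K2LiuSiegelBigCellSectionOfLocalPrelims   -- ★ `placesEmbed` letters, `split_of_isSiegelDelta_placesEmbed`, (c0) `modDelta_eq_one_of_mem_KS`, adapted groups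
import Summits.HodgeConjecture.HodgeConjecture.Theorems.K2LiuIwasawaDeltaUnimodular            -- ★ `IwasawaDatum.modDelta_eq_one_of_mem`, `modDelta_eq_one_of_mem_compact_subgroup`
import Literature.NumberTheory.K2Lit.SiegelStandardExtension                                     -- ★ `IwasawaDatum.pPart∕kPart`, `IsDeltaUnimodular`, `modDelta_pPart_eq`
import Literature.NumberTheory.K2Lit.SiegelStandardIwasawaData                                   -- ★ `IwasawaDatum.IsStd.exists_fin`
import HarnessLib

/-!
# Crux `HLiu418`, road `K2_Liu`, #41 (β) Euler face, (E6) FILE 1: the Iwasawa height `|det_Δ p_h|^{1∕2}` factors over the places on the slice `H_∞ × ∏_{v∈T} H_v`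

Cell `hodgecm-mathlib`, crux item hLiu418 = `stmt-HodgeConjecture-24832`; squad K2 ∕ K2Liu; prover K2Liu-p03 (g7).  THEOREMS ONLY (no `def`, no instance, no notation,
no named-fact hypothesis, no `sorry`); lane `--supports stmt-HodgeConjecture-24832 --as helper`.

For an Iwasawa datum `𝒦` the height `M(h) := modDelta (𝒦.pPart h) = |det_Δ p_h|^{1∕2}` (★ K2Lit `SiegelStandardExtension`) carries the flat extension `f_s(h) = M(h)^{2(s−s₀)} f_{s₀}(h)` of a
standard family.  For `𝒦` STANDARD (`K = C_∞ × C_f`, `C_f` open compact — NOT assumed to be a product over places) and `T` a finite set of places OFF which `(𝒦.K)_v ⊆ K_{H,v}`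
(★ G2 §0 `exists_finset_forall_evalPlace_finPart_mem_localInt`), the height nevertheless FACTORS on the slice: for `x = placesEmbed_T(y_∞, y_T)`,
`M(x) = M(y_∞, 1) · ∏_{v∈T} M(ι_v(y_v))` (**`modDelta_pPart_placesEmbed`**).  PROOF (no product structure needed): (§1) `M(h) = modDelta r` for ANY `r ∈ P_Δ(𝔸)` with
`κ := r⁻¹h` «componentwise in `K`» — `κ_∞ ∈ (𝒦.K)_∞`, `κ_v ∈ (𝒦.K)_v` (`v ∈ T`), `κ_v ∈ K_{H,v}` (`v ∉ T`) — because `e := r⁻¹ p_h = κ k_h⁻¹ ∈ P_Δ(𝔸)` splits as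
`e_∞ · placesEmbed_T(1, e_T) · e^T` with `e_∞ ∈ P ∩ Ad(K, ∅)`, each `ι_v(e_v) ∈ P ∩ Ad(K, {v})` (★ adapted compact subgroups `exists_subgroup_adapted`∕`isCompact_adapted`, ★
`modDelta_eq_one_of_mem_compact_subgroup`; the one-place memberships use `(1, k_f) ∈ 𝒦.K`, ★ `IsStd.exists_fin`) and `e^T ∈ P ∩ K^T_H` (★ (c0) `modDelta_eq_one_of_mem_KS`); the product over
`T` is read through `δ_{1,(1−n)∕2} = modDelta` (★ `split_of_isSiegelDelta_placesEmbed` at the trivial character); (§2) apply §1 to `x`, to `(y_∞,1)` and to every `ι_v(y_v)` with the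
componentwise `P`-parts `y_∞ (k_a)_∞⁻¹`, `y_v (k_v)_v⁻¹` of the honest decompositions.
[Tan1999, §1]; [BorelJacquet1979, §4.1]; [GelbartRogawski1991, §3.1 (3.1.2)–(3.1.3)]; [MoeglinWaldspurger1995, I.2.2].
HONEST LABEL.  Count-neutral helper: `HC_CM` is proved only modulo the 7 printed citations (2 remaining named inputs: hLiu418 = `stmt-HodgeConjecture-24832`,
h413 = `stmt-HodgeConjecture-24833`) until rung 0 closes.
-/

set_option autoImplicit false
set_option linter.dupNamespace false -- the mandated namespace repeats `HodgeConjecture.HodgeConjecture`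

noncomputable section

open scoped Matrix RestrictedProduct
open Filter Topology Set NumberField IsDedekindDomain
open Literature.NumberTheory.Automorphic Literature.NumberTheory.Automorphic.UnitaryGroup Literature.NumberTheory.GaloisRepresentations
open Literature.NumberTheory.GelbartRogawski1991 Literature.NumberTheory.GelbartRogawski1991.GRConstruction
open Literature.NumberTheory.K2Lit.SiegelDoubled Literature.NumberTheory.K2Lit.PlaceSplitting
open Summit.HodgeConjecture.HodgeConjecture.Cruxes.HLiu418.K2LiuStdFamilyFactorisable
open Summit.HodgeConjecture.HodgeConjecture.Cruxes.HLiu418.K2LiuSiegelSectionRestrictedProduct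
open Summit.HodgeConjecture.HodgeConjecture.Cruxes.HLiu418.K2LiuSiegelCharacterTrivialOnKS
open Summit.HodgeConjecture.HodgeConjecture.Cruxes.HLiu418.K2LiuIwasawaDeltaUnimodular
open Summit.HodgeConjecture.HodgeConjecture.Cruxes.HLiu418.K2LiuSiegelBigCellSectionOfLocalPrelims

namespace Summit.HodgeConjecture.HodgeConjecture.Cruxes.HLiu418.K2LiuIwasawaHeightPlaceFactorisation

variable (L : Type) [Field L] [NumberField L] [IsCMField L]
variable {N M n : ℕ} (e : Fin N × Fin M ≃ Fin n)
  (dV : Fin N → L) (hdV : ∀ i, IsCMField.complexConj L (dV i) = dV i) (hdV0 : ∀ i, dV i ≠ 0)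
  (dW : Fin M → L) (hdW : ∀ i, IsCMField.complexConj L (dW i) = dW i) (hdW0 : ∀ i, dW i ≠ 0)

/-! ## §0 `modDelta` at the trivial character: `δ_{1,(1−n)∕2} = |det_Δ ·|^{1∕2}` -/

/-- `(modDelta p : ℂ) = δ_{1,(1−n)∕2}(p)` (exponent `2s + n = 1`; `chiDet 1 = 1` as ★ `K2LiuNonsplitCartanDecayInert.chiDet_one_character`, general frame sizes here).
[cite: Tan1999, §1] -/
theorem coe_modDelta_eq_siegelDeltaCharacter_one (p : HA L e dV hdV dW hdW) :
    (modDelta L e dV hdV dW hdW p : ℂ) = siegelDeltaCharacter L e dV hdV dW hdW 1 ((1 - (n : ℂ)) / 2) p := by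
  have h1 : chiDet L e dV hdV dW hdW (1 : HeckeCharacter L) p = 1 := by
    unfold chiDet
    split_ifs <;> rfl
  rw [siegelDeltaCharacter, h1, Units.val_one, one_mul, show 2 * ((1 - (n : ℂ)) / 2) + (n : ℂ) = 1 by ring, Complex.cpow_one]

/-! ## §1 Moduli of «componentwise-in-`K`» Siegel elements are `1` -/

set_option maxHeartbeats 800000 in -- the adelic doubled unitary datum (as ★ (c0))
include hdV0 hdW0 in
/-- a Siegel element with trivial finite part whose archimedean part is that of some `k ∈ 𝒦.K` has modulus `1` (it lies in the compact adapted group `Ad(𝒦.K, ∅)`;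
★ `modDelta_eq_one_of_mem_compact_subgroup`). [cite: BorelJacquet1979, §4.1] [cite: MoeglinWaldspurger1995, I.2.2] -/
theorem modDelta_eq_one_of_archPart_eq (𝒦 : IwasawaDatum L e dV hdV dW hdW) {g k₉ : HA L e dV hdV dW hdW} (hg : IsSiegelDelta L e dV hdV dW hdW g) (hk₉ : k₉ ∈ 𝒦.K)
    (harch : UnitaryGroup.archPart (Fp L) L (IsCMField.complexConj L) (n + n) (hermD L e dV hdV dW hdW) k₉ = UnitaryGroup.archPart (Fp L) L (IsCMField.complexConj L) (n + n) (hermD L e dV hdV dW hdW) g) (hfin : ∀ v, UnitaryGroup.evalPlace (Fp L) L (IsCMField.complexConj L) (n + n) (hermD L e dV hdV dW hdW) v (UnitaryGroup.finPart (Fp L) L (IsCMField.complexConj L) (n + n) (hermD L e dV hdV dW hdW) g) ∈ UnitaryGroup.localInt L (IsCMField.complexConj L) (n + n) (hermD L e dV hdV dW hdW) v) :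
    modDelta L e dV hdV dW hdW g = 1 := by
  obtain ⟨C, hC⟩ := K2LiuIwasawaDatumAdapted.exists_subgroup_adapted L e dV hdV dW hdW 𝒦.K (∅ : Finset (HeightOneSpectrum (𝓞 (Fp L))))
  exact modDelta_eq_one_of_mem_compact_subgroup L e dV hdV hdV0 dW hdW hdW0 C (K2LiuIwasawaDatumAdapted.isCompact_adapted L e dV hdV dW hdW 𝒦.isCompact_K ∅ hC)
    ((hC g).2 ⟨⟨k₉, hk₉, harch, fun v => absurd v.2 (Finset.notMem_empty _)⟩, fun v _ => hfin v⟩) hg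

set_option maxHeartbeats 800000 in -- the adelic doubled unitary datum (as ★ (c0))
include hdV0 hdW0 in
/-- a Siegel element `ι_v(u)` whose component `u` is the `v`-component of some `k ∈ 𝒦.K`, `𝒦` standard, has modulus `1` (`(1, k_f) ∈ 𝒦.K`, the adapted group `Ad(𝒦.K, {v})`).
[cite: BorelJacquet1979, §4.1] [cite: Tan1999, §1 p. 166] -/
theorem modDelta_locToAdelic_eq_one_of_evalPlace_eq {𝒦 : IwasawaDatum L e dV hdV dW hdW} (h𝒦 : 𝒦.IsStd) (v : HeightOneSpectrum (𝓞 (Fp L)))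
    {u : UnitaryGroup.localPi L (IsCMField.complexConj L) (n + n) (hermD L e dV hdV dW hdW) v} (hu : u ∈ siegelDeltaLoc L e dV hdV dW hdW v) {k₉ : HA L e dV hdV dW hdW} (hk₉ : k₉ ∈ 𝒦.K) (hv : UnitaryGroup.evalPlace (Fp L) L (IsCMField.complexConj L) (n + n) (hermD L e dV hdV dW hdW) v (UnitaryGroup.finPart (Fp L) L (IsCMField.complexConj L) (n + n) (hermD L e dV hdV dW hdW) k₉) = u) :
    modDelta L e dV hdV dW hdW (locToAdelic L e dV hdV dW hdW v u) = 1 := by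
  classical
  obtain ⟨Cfin, -, hCK, hKC⟩ := h𝒦.exists_fin
  -- `k' := (1, k₉,f) ∈ 𝒦.K`
  have hk' : (finAdelicToAdelic (Fp L) L (IsCMField.complexConj L) (n + n) (hermD L e dV hdV dW hdW) (UnitaryGroup.finPart (Fp L) L (IsCMField.complexConj L) (n + n) (hermD L e dV hdV dW hdW) k₉) : HA L e dV hdV dW hdW) ∈ 𝒦.K := hCK _ (hKC k₉ hk₉)
  obtain ⟨C, hC⟩ := K2LiuIwasawaDatumAdapted.exists_subgroup_adapted L e dV hdV dW hdW 𝒦.K ({v} : Finset (HeightOneSpectrum (𝓞 (Fp L))))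
  refine modDelta_eq_one_of_mem_compact_subgroup L e dV hdV hdV0 dW hdW hdW0 C (K2LiuIwasawaDatumAdapted.isCompact_adapted L e dV hdV dW hdW 𝒦.isCompact_K _ hC)
    ((hC _).2 ⟨⟨_, hk', ?_, fun w => ?_⟩, fun w hw => ?_⟩) ((mem_siegelDeltaLoc_iff L e dV hdV dW hdW v u).1 hu)
  · rw [archPart_finAdelicToAdelic, archPart_locToAdelic]
  · have hw : (w : HeightOneSpectrum (𝓞 (Fp L))) = v := Finset.mem_singleton.1 w.2
    rw [finPart_finAdelicToAdelic, hw, evalPlace_finPart_locToAdelic_self, hv]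
  · rw [evalPlace_finPart_locToAdelic_of_ne L e dV hdV dW hdW (fun h => hw (Finset.mem_singleton.2 h)) u]
    exact one_mem _

variable (T : Finset (HeightOneSpectrum (𝓞 (Fp L)))) [DecidableEq (HeightOneSpectrum (𝓞 (Fp L)))]

set_option maxHeartbeats 800000 in -- as above
include hdV0 hdW0 in
/-- **`modDelta (placesEmbed_T (1, w)) = 1`** when every `w_v` is a Siegel `v`-component of some element of `𝒦.K` (`𝒦` standard): read the modulus as `δ_{1,(1−n)∕2}`, split over `T`
(★ `siegelDeltaCharacter_placesEmbed_one`) and use the one-place lemma. [cite: Tan1999, §1] [cite: BorelJacquet1979, §4.1] -/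
theorem modDelta_placesEmbed_one_eq_one {𝒦 : IwasawaDatum L e dV hdV dW hdW} (h𝒦 : 𝒦.IsStd)
    (w : Π v : T, UnitaryGroup.localPi L (IsCMField.complexConj L) (n + n) (hermD L e dV hdV dW hdW) v.1) (hw : ∀ v : T, w v ∈ siegelDeltaLoc L e dV hdV dW hdW v.1)
    (hwK : ∀ v : T, ∃ k₉ ∈ 𝒦.K, UnitaryGroup.evalPlace (Fp L) L (IsCMField.complexConj L) (n + n) (hermD L e dV hdV dW hdW) v.1 (UnitaryGroup.finPart (Fp L) L (IsCMField.complexConj L) (n + n) (hermD L e dV hdV dW hdW) k₉) = w v) :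
    modDelta L e dV hdV dW hdW (placesEmbed L (hermD L e dV hdV dW hdW) T (1, w)) = 1 := by
  have h1 := coe_modDelta_eq_siegelDeltaCharacter_one L e dV hdV dW hdW (placesEmbed L (hermD L e dV hdV dW hdW) T (1, w))
  rw [siegelDeltaCharacter_placesEmbed_one L e dV hdV dW hdW T 1 ((1 - (n : ℂ)) / 2) w hw, Finset.prod_eq_one] at h1
  · exact_mod_cast h1
  · intro v _
    obtain ⟨k₉, hk₉, hv⟩ := hwK v
    rw [siegelCharLoc_apply, ← coe_modDelta_eq_siegelDeltaCharacter_one, modDelta_locToAdelic_eq_one_of_evalPlace_eq L e dV hdV hdV0 dW hdW hdW0 h𝒦 v.1 (hw v) hk₉ hv,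
      Complex.ofReal_one]

/-! ## §2 `M(h) = modDelta r` for ANY componentwise-in-`K` quotient `r⁻¹ h` -/

set_option maxHeartbeats 1600000 in -- as above, three moduli
include hdV0 hdW0 in
/-- **THE HEIGHT FROM A COMPONENTWISE DECOMPOSITION.**  `𝒦` standard, `T ⊇` the places where `(𝒦.K)_v ⊄ K_{H,v}`; if `r ∈ P_Δ(𝔸)` and `κ := r⁻¹ h` has archimedean part the
archimedean part of SOME element of `𝒦.K`, `v`-component the `v`-component of SOME element of `𝒦.K` for `v ∈ T`, and integral components off `T`, then
`modDelta (𝒦.pPart h) = modDelta r`. [cite: Tan1999, §1] [cite: BorelJacquet1979, §4.1] [cite: MoeglinWaldspurger1995, I.2.2] -/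
theorem modDelta_pPart_eq_of_componentwise {𝒦 : IwasawaDatum L e dV hdV dW hdW} (h𝒦 : 𝒦.IsStd)
    (hKT : ∀ k ∈ 𝒦.K, ∀ v, v ∉ T → UnitaryGroup.evalPlace (Fp L) L (IsCMField.complexConj L) (n + n) (hermD L e dV hdV dW hdW) v (UnitaryGroup.finPart (Fp L) L (IsCMField.complexConj L) (n + n) (hermD L e dV hdV dW hdW) k) ∈ UnitaryGroup.localInt L (IsCMField.complexConj L) (n + n) (hermD L e dV hdV dW hdW) v)
    (h r κ : HA L e dV hdV dW hdW) (hr : IsSiegelDelta L e dV hdV dW hdW r) (hκ : r⁻¹ * h = κ)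
    (harch : ∃ k₉ ∈ 𝒦.K, UnitaryGroup.archPart (Fp L) L (IsCMField.complexConj L) (n + n) (hermD L e dV hdV dW hdW) k₉ = UnitaryGroup.archPart (Fp L) L (IsCMField.complexConj L) (n + n) (hermD L e dV hdV dW hdW) κ)
    (hT : ∀ v ∈ T, ∃ k₉ ∈ 𝒦.K, UnitaryGroup.evalPlace (Fp L) L (IsCMField.complexConj L) (n + n) (hermD L e dV hdV dW hdW) v (UnitaryGroup.finPart (Fp L) L (IsCMField.complexConj L) (n + n) (hermD L e dV hdV dW hdW) k₉) = UnitaryGroup.evalPlace (Fp L) L (IsCMField.complexConj L) (n + n) (hermD L e dV hdV dW hdW) v (UnitaryGroup.finPart (Fp L) L (IsCMField.complexConj L) (n + n) (hermD L e dV hdV dW hdW) κ))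
    (hoff : ∀ v, v ∉ T → UnitaryGroup.evalPlace (Fp L) L (IsCMField.complexConj L) (n + n) (hermD L e dV hdV dW hdW) v (UnitaryGroup.finPart (Fp L) L (IsCMField.complexConj L) (n + n) (hermD L e dV hdV dW hdW) κ) ∈ UnitaryGroup.localInt L (IsCMField.complexConj L) (n + n) (hermD L e dV hdV dW hdW) v) :
    modDelta L e dV hdV dW hdW (𝒦.pPart h) = modDelta L e dV hdV dW hdW r := by
  classical
  have hK : 𝒦.IsDeltaUnimodular := IwasawaDatum.modDelta_eq_one_of_mem L e dV hdV hdV0 dW hdW hdW0 𝒦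
  -- `e := r⁻¹ · pPart h = (r⁻¹ h) · (kPart h)⁻¹ ∈ P_Δ(𝔸)`
  have hph : 𝒦.pPart h = h * (𝒦.kPart h)⁻¹ := eq_mul_inv_of_mul_eq (𝒦.pPart_mul_kPart h)
  have hdec : r⁻¹ * 𝒦.pPart h = κ * (𝒦.kPart h)⁻¹ := by rw [hph, ← mul_assoc, hκ]
  have heΔ : IsSiegelDelta L e dV hdV dW hdW (r⁻¹ * 𝒦.pPart h) := isSiegelDelta_mul L e dV hdV dW hdW (isSiegelDelta_inv L e dV hdV dW hdW hr) (𝒦.pPart_isSiegelDelta h)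
  suffices hone : modDelta L e dV hdV dW hdW (r⁻¹ * 𝒦.pPart h) = 1 by
    have h2 : 𝒦.pPart h = r * (r⁻¹ * 𝒦.pPart h) := by rw [mul_inv_cancel_left]
    rw [h2, modDelta_mul L e dV hdV dW hdW hr heΔ, hone, mul_one]
  -- components of `e`
  have hkh := 𝒦.kPart_mem h
  have he_arch : ∃ k₉ ∈ 𝒦.K, UnitaryGroup.archPart (Fp L) L (IsCMField.complexConj L) (n + n) (hermD L e dV hdV dW hdW) k₉ = UnitaryGroup.archPart (Fp L) L (IsCMField.complexConj L) (n + n) (hermD L e dV hdV dW hdW) (r⁻¹ * 𝒦.pPart h) := by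
    obtain ⟨k₉, hk₉, hk₉a⟩ := harch
    refine ⟨k₉ * (𝒦.kPart h)⁻¹, 𝒦.K.mul_mem hk₉ (𝒦.K.inv_mem hkh), ?_⟩
    rw [hdec, K2LiuStdFamilyFactorisable.archPart_mul' L e dV hdV dW hdW k₉, K2LiuStdFamilyFactorisable.archPart_mul' L e dV hdV dW hdW κ, hk₉a]
  have he_T : ∀ v ∈ T, ∃ k₉ ∈ 𝒦.K, UnitaryGroup.evalPlace (Fp L) L (IsCMField.complexConj L) (n + n) (hermD L e dV hdV dW hdW) v (UnitaryGroup.finPart (Fp L) L (IsCMField.complexConj L) (n + n) (hermD L e dV hdV dW hdW) k₉) = UnitaryGroup.evalPlace (Fp L) L (IsCMField.complexConj L) (n + n) (hermD L e dV hdV dW hdW) v (UnitaryGroup.finPart (Fp L) L (IsCMField.complexConj L) (n + n) (hermD L e dV hdV dW hdW) (r⁻¹ * 𝒦.pPart h)) := fun v hv => by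
    obtain ⟨k₉, hk₉, hk₉v⟩ := hT v hv
    refine ⟨k₉ * (𝒦.kPart h)⁻¹, 𝒦.K.mul_mem hk₉ (𝒦.K.inv_mem hkh), ?_⟩
    rw [hdec, evalPlace_finPart_mul' L e dV hdV dW hdW v k₉, evalPlace_finPart_mul' L e dV hdV dW hdW v κ, hk₉v]
  have he_off : ∀ v, v ∉ T → UnitaryGroup.evalPlace (Fp L) L (IsCMField.complexConj L) (n + n) (hermD L e dV hdV dW hdW) v (UnitaryGroup.finPart (Fp L) L (IsCMField.complexConj L) (n + n) (hermD L e dV hdV dW hdW) (r⁻¹ * 𝒦.pPart h)) ∈ UnitaryGroup.localInt L (IsCMField.complexConj L) (n + n) (hermD L e dV hdV dW hdW) v := fun v hv => by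
    rw [hdec, evalPlace_finPart_mul' L e dV hdV dW hdW v κ, evalPlace_finPart_inv']
    exact mul_mem (hoff v hv) (inv_mem (hKT _ hkh v hv))
  -- split `e = e_∞ · e_f`, `e_f = e_T · e^T`; name the pieces
  obtain ⟨E, hE⟩ : ∃ E : HA L e dV hdV dW hdW, E = r⁻¹ * 𝒦.pPart h := ⟨_, rfl⟩
  rw [← hE] at heΔ he_arch he_T he_off ⊢
  obtain ⟨eA, heA⟩ : ∃ eA : HA L e dV hdV dW hdW, eA = UnitaryGroup.archToAdelic (Fp L) L (IsCMField.complexConj L) (n + n) (hermD L e dV hdV dW hdW) (UnitaryGroup.archPart (Fp L) L (IsCMField.complexConj L) (n + n) (hermD L e dV hdV dW hdW) E) := ⟨_, rfl⟩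
  obtain ⟨eF, heF⟩ : ∃ eF : HA L e dV hdV dW hdW, eF = finAdelicToAdelic (Fp L) L (IsCMField.complexConj L) (n + n) (hermD L e dV hdV dW hdW) (UnitaryGroup.finPart (Fp L) L (IsCMField.complexConj L) (n + n) (hermD L e dV hdV dW hdW) E) := ⟨_, rfl⟩
  obtain ⟨eT, heT⟩ : ∃ eT : HA L e dV hdV dW hdW, eT = placesEmbed L (hermD L e dV hdV dW hdW) T (1, fun v : T => UnitaryGroup.evalPlace (Fp L) L (IsCMField.complexConj L) (n + n) (hermD L e dV hdV dW hdW) v.1 (UnitaryGroup.finPart (Fp L) L (IsCMField.complexConj L) (n + n) (hermD L e dV hdV dW hdW) E)) := ⟨_, rfl⟩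
  have hEsplit : E = eA * eF := by
    refine eq_of_archPart_eq_of_finPart_eq L e dV hdV dW hdW _ _ ?_ ?_
    · rw [K2LiuStdFamilyFactorisable.archPart_mul', heA, heF, archPart_archToAdelic, archPart_finAdelicToAdelic, mul_one]
    · refine UnitaryGroup.eq_of_forall_evalPlace_eq (Fp L) L (IsCMField.complexConj L) (n + n) (hermD L e dV hdV dW hdW) fun w => ?_
      rw [evalPlace_finPart_mul', heA, heF, finPart_archToAdelic, finPart_finAdelicToAdelic, map_one, one_mul]
  have heFΔ : IsSiegelDelta L e dV hdV dW hdW eF := by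
    rw [heF]
    exact K2LiuIwasawaDatumAdapted.isSiegelDelta_finAdelicToAdelic_of_forall_mem_siegelDeltaLoc L e dV hdV dW hdW _ fun v => evalPlace_finPart_mem_siegelDeltaLoc L e dV hdV dW hdW E heΔ v
  have heAΔ : IsSiegelDelta L e dV hdV dW hdW eA := by
    have h1 := isSiegelDelta_mul L e dV hdV dW hdW heΔ (isSiegelDelta_inv L e dV hdV dW hdW heFΔ)
    rwa [hEsplit, mul_inv_cancel_right] at h1
  have heTΔ : IsSiegelDelta L e dV hdV dW hdW eT := by
    rw [heT]
    exact isSiegelDelta_placesEmbed_one L e dV hdV dW hdW T _ fun v => evalPlace_finPart_mem_siegelDeltaLoc L e dV hdV dW hdW E heΔ v.1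
  have heTinvF : IsSiegelDelta L e dV hdV dW hdW (eT⁻¹ * eF) := isSiegelDelta_mul L e dV hdV dW hdW (isSiegelDelta_inv L e dV hdV dW hdW heTΔ) heFΔ
  -- the three moduli are `1`
  have hA1 : modDelta L e dV hdV dW hdW eA = 1 := by
    obtain ⟨k₉, hk₉, hk₉a⟩ := he_arch
    refine modDelta_eq_one_of_archPart_eq L e dV hdV hdV0 dW hdW hdW0 𝒦 heAΔ hk₉ (by rw [hk₉a, heA, archPart_archToAdelic]) fun v => ?_
    rw [heA, finPart_archToAdelic, map_one]
    exact one_mem _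
  have hT1 : modDelta L e dV hdV dW hdW eT = 1 := by
    rw [heT]
    exact modDelta_placesEmbed_one_eq_one L e dV hdV hdV0 dW hdW hdW0 T h𝒦 _ (fun v => evalPlace_finPart_mem_siegelDeltaLoc L e dV hdV dW hdW E heΔ v.1)
      fun v => he_T v.1 v.2
  have hR1 : modDelta L e dV hdV dW hdW (eT⁻¹ * eF) = 1 := by
    refine modDelta_eq_one_of_mem_KS L e dV hdV hdV0 dW hdW hdW0 T (eT⁻¹ * eF) heTinvF ?_ (fun v => ?_) (fun v hv => ?_)
    · rw [K2LiuStdFamilyFactorisable.archPart_mul', K2LiuStdFamilyFactorisable.archPart_inv', heT, archPart_placesEmbed, inv_one, one_mul, heF, archPart_finAdelicToAdelic]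
    · rw [evalPlace_finPart_mul', evalPlace_finPart_inv', heF, finPart_finAdelicToAdelic]
      by_cases hv : v ∈ T
      · rw [heT, evalPlace_finPart_placesEmbed_of_mem L e dV hdV dW hdW T _ _ v hv, inv_mul_cancel]; exact one_mem _
      · rw [heT, evalPlace_finPart_placesEmbed_of_not_mem L e dV hdV dW hdW T _ _ v hv, inv_one, one_mul]; exact he_off v hv
    · rw [evalPlace_finPart_mul', evalPlace_finPart_inv', heF, finPart_finAdelicToAdelic, heT, evalPlace_finPart_placesEmbed_of_mem L e dV hdV dW hdW T _ _ v hv,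
        inv_mul_cancel]
  have hEfac : E = eA * (eT * (eT⁻¹ * eF)) := by rw [mul_inv_cancel_left, hEsplit]
  rw [hEfac, modDelta_mul L e dV hdV dW hdW heAΔ (isSiegelDelta_mul L e dV hdV dW hdW heTΔ heTinvF), modDelta_mul L e dV hdV dW hdW heTΔ heTinvF, hA1, hT1, hR1]
  norm_num

/-! ## §3 The factorisation on the slice `H_∞ × ∏_{v∈T} H_v` -/

set_option maxHeartbeats 1600000 in -- as above
include hdV0 hdW0 in
/-- **THE IWASAWA HEIGHT FACTORS OVER THE PLACES ON THE SLICE**: for `𝒦` standard and `(𝒦.K)_v ⊆ K_{H,v}` off `T`,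
`M(placesEmbed_T(y_∞, y)) = M(y_∞, 1) · ∏_{v∈T} M(ι_v(y_v))`, `M := modDelta ∘ 𝒦.pPart`. [cite: Tan1999, §1] [cite: BorelJacquet1979, §4.1] [cite: MoeglinWaldspurger1995, I.2.2] -/
theorem modDelta_pPart_placesEmbed {𝒦 : IwasawaDatum L e dV hdV dW hdW} (h𝒦 : 𝒦.IsStd)
    (hKT : ∀ k ∈ 𝒦.K, ∀ v, v ∉ T → UnitaryGroup.evalPlace (Fp L) L (IsCMField.complexConj L) (n + n) (hermD L e dV hdV dW hdW) v (UnitaryGroup.finPart (Fp L) L (IsCMField.complexConj L) (n + n) (hermD L e dV hdV dW hdW) k) ∈ UnitaryGroup.localInt L (IsCMField.complexConj L) (n + n) (hermD L e dV hdV dW hdW) v)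
    (yi : UnitaryGroup.arch (Fp L) L (IsCMField.complexConj L) (n + n) (hermD L e dV hdV dW hdW)) (y : Π v : T, UnitaryGroup.localPi L (IsCMField.complexConj L) (n + n) (hermD L e dV hdV dW hdW) v.1) :
    modDelta L e dV hdV dW hdW (𝒦.pPart (placesEmbed L (hermD L e dV hdV dW hdW) T (yi, y))) =
      modDelta L e dV hdV dW hdW (𝒦.pPart (UnitaryGroup.archToAdelic (Fp L) L (IsCMField.complexConj L) (n + n) (hermD L e dV hdV dW hdW) yi)) * ∏ v : T, modDelta L e dV hdV dW hdW (𝒦.pPart (locToAdelic L e dV hdV dW hdW v.1 (y v))) := by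
  classical
  -- the honest decompositions of the embedded factors and their componentwise `P`-parts
  have hka := 𝒦.kPart_mem (UnitaryGroup.archToAdelic (Fp L) L (IsCMField.complexConj L) (n + n) (hermD L e dV hdV dW hdW) yi)
  have hkv : ∀ v : T, 𝒦.kPart (locToAdelic L e dV hdV dW hdW v.1 (y v)) ∈ 𝒦.K := fun v => 𝒦.kPart_mem _
  -- `P`-components: `a′ := yi · (k_a)_∞⁻¹ = (pPart (yi,1))_∞`, `w v := y_v (k_v)_v⁻¹ = (pPart ι_v(y_v))_v`
  have hpa : UnitaryGroup.archPart (Fp L) L (IsCMField.complexConj L) (n + n) (hermD L e dV hdV dW hdW) (𝒦.pPart (UnitaryGroup.archToAdelic (Fp L) L (IsCMField.complexConj L) (n + n) (hermD L e dV hdV dW hdW) yi)) = yi * (UnitaryGroup.archPart (Fp L) L (IsCMField.complexConj L) (n + n) (hermD L e dV hdV dW hdW) (𝒦.kPart (UnitaryGroup.archToAdelic (Fp L) L (IsCMField.complexConj L) (n + n) (hermD L e dV hdV dW hdW) yi)))⁻¹ := by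
    have h1 := congrArg (UnitaryGroup.archPart (Fp L) L (IsCMField.complexConj L) (n + n) (hermD L e dV hdV dW hdW)) (𝒦.pPart_mul_kPart (UnitaryGroup.archToAdelic (Fp L) L (IsCMField.complexConj L) (n + n) (hermD L e dV hdV dW hdW) yi))
    rw [K2LiuStdFamilyFactorisable.archPart_mul', archPart_archToAdelic] at h1
    exact eq_mul_inv_of_mul_eq h1
  have hpv : ∀ v : T, UnitaryGroup.evalPlace (Fp L) L (IsCMField.complexConj L) (n + n) (hermD L e dV hdV dW hdW) v.1 (UnitaryGroup.finPart (Fp L) L (IsCMField.complexConj L) (n + n) (hermD L e dV hdV dW hdW) (𝒦.pPart (locToAdelic L e dV hdV dW hdW v.1 (y v)))) = y v * (UnitaryGroup.evalPlace (Fp L) L (IsCMField.complexConj L) (n + n) (hermD L e dV hdV dW hdW) v.1 (UnitaryGroup.finPart (Fp L) L (IsCMField.complexConj L) (n + n) (hermD L e dV hdV dW hdW) (𝒦.kPart (locToAdelic L e dV hdV dW hdW v.1 (y v)))))⁻¹ := fun v => by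
    have h1 := congrArg (fun x => UnitaryGroup.evalPlace (Fp L) L (IsCMField.complexConj L) (n + n) (hermD L e dV hdV dW hdW) v.1 (UnitaryGroup.finPart (Fp L) L (IsCMField.complexConj L) (n + n) (hermD L e dV hdV dW hdW) x)) (𝒦.pPart_mul_kPart (locToAdelic L e dV hdV dW hdW v.1 (y v)))
    simp only [evalPlace_finPart_mul', evalPlace_finPart_locToAdelic_self] at h1
    exact eq_mul_inv_of_mul_eq h1
  -- the componentwise `P`-part `r := placesEmbed_T (a′, w)` and its pieces
  have haΔ : IsSiegelDelta L e dV hdV dW hdW (UnitaryGroup.archToAdelic (Fp L) L (IsCMField.complexConj L) (n + n) (hermD L e dV hdV dW hdW) (yi * (UnitaryGroup.archPart (Fp L) L (IsCMField.complexConj L) (n + n) (hermD L e dV hdV dW hdW) (𝒦.kPart (UnitaryGroup.archToAdelic (Fp L) L (IsCMField.complexConj L) (n + n) (hermD L e dV hdV dW hdW) yi)))⁻¹)) := by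
    -- `= archToAdelic (archPart (pPart (yi,1)))`, the archimedean part of a Siegel element
    have hp := 𝒦.pPart_isSiegelDelta (UnitaryGroup.archToAdelic (Fp L) L (IsCMField.complexConj L) (n + n) (hermD L e dV hdV dW hdW) yi)
    have hF : IsSiegelDelta L e dV hdV dW hdW (finAdelicToAdelic (Fp L) L (IsCMField.complexConj L) (n + n) (hermD L e dV hdV dW hdW) (UnitaryGroup.finPart (Fp L) L (IsCMField.complexConj L) (n + n) (hermD L e dV hdV dW hdW) (𝒦.pPart (UnitaryGroup.archToAdelic (Fp L) L (IsCMField.complexConj L) (n + n) (hermD L e dV hdV dW hdW) yi)))) :=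
      K2LiuIwasawaDatumAdapted.isSiegelDelta_finAdelicToAdelic_of_forall_mem_siegelDeltaLoc L e dV hdV dW hdW _ fun v => evalPlace_finPart_mem_siegelDeltaLoc L e dV hdV dW hdW _ hp v
    obtain ⟨pA, hpA⟩ : ∃ pA : HA L e dV hdV dW hdW, pA = UnitaryGroup.archToAdelic (Fp L) L (IsCMField.complexConj L) (n + n) (hermD L e dV hdV dW hdW) (UnitaryGroup.archPart (Fp L) L (IsCMField.complexConj L) (n + n) (hermD L e dV hdV dW hdW) (𝒦.pPart (UnitaryGroup.archToAdelic (Fp L) L (IsCMField.complexConj L) (n + n) (hermD L e dV hdV dW hdW) yi))) := ⟨_, rfl⟩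
    obtain ⟨pF, hpF⟩ : ∃ pF : HA L e dV hdV dW hdW, pF = finAdelicToAdelic (Fp L) L (IsCMField.complexConj L) (n + n) (hermD L e dV hdV dW hdW) (UnitaryGroup.finPart (Fp L) L (IsCMField.complexConj L) (n + n) (hermD L e dV hdV dW hdW) (𝒦.pPart (UnitaryGroup.archToAdelic (Fp L) L (IsCMField.complexConj L) (n + n) (hermD L e dV hdV dW hdW) yi))) := ⟨_, rfl⟩
    rw [← hpF] at hF
    have hsplit : 𝒦.pPart (UnitaryGroup.archToAdelic (Fp L) L (IsCMField.complexConj L) (n + n) (hermD L e dV hdV dW hdW) yi) = pA * pF := by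
      refine eq_of_archPart_eq_of_finPart_eq L e dV hdV dW hdW _ _ ?_ ?_
      · rw [K2LiuStdFamilyFactorisable.archPart_mul', hpA, hpF, archPart_archToAdelic, archPart_finAdelicToAdelic, mul_one]
      · refine UnitaryGroup.eq_of_forall_evalPlace_eq (Fp L) L (IsCMField.complexConj L) (n + n) (hermD L e dV hdV dW hdW) fun w => ?_
        rw [evalPlace_finPart_mul', hpA, hpF, finPart_archToAdelic, finPart_finAdelicToAdelic, map_one, one_mul]
    have h1 := isSiegelDelta_mul L e dV hdV dW hdW hp (isSiegelDelta_inv L e dV hdV dW hdW hF)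
    rw [hsplit, mul_inv_cancel_right, hpA, hpa] at h1
    exact h1
  have hwΔ : ∀ v : T, y v * (UnitaryGroup.evalPlace (Fp L) L (IsCMField.complexConj L) (n + n) (hermD L e dV hdV dW hdW) v.1 (UnitaryGroup.finPart (Fp L) L (IsCMField.complexConj L) (n + n) (hermD L e dV hdV dW hdW) (𝒦.kPart (locToAdelic L e dV hdV dW hdW v.1 (y v)))))⁻¹ ∈ siegelDeltaLoc L e dV hdV dW hdW v.1 := fun v => by
    rw [← hpv v]; exact evalPlace_finPart_mem_siegelDeltaLoc L e dV hdV dW hdW _ (𝒦.pPart_isSiegelDelta _) v.1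
  have hrΔ : IsSiegelDelta L e dV hdV dW hdW (placesEmbed L (hermD L e dV hdV dW hdW) T (yi * (UnitaryGroup.archPart (Fp L) L (IsCMField.complexConj L) (n + n) (hermD L e dV hdV dW hdW) (𝒦.kPart (UnitaryGroup.archToAdelic (Fp L) L (IsCMField.complexConj L) (n + n) (hermD L e dV hdV dW hdW) yi)))⁻¹,
      fun v : T => y v * (UnitaryGroup.evalPlace (Fp L) L (IsCMField.complexConj L) (n + n) (hermD L e dV hdV dW hdW) v.1 (UnitaryGroup.finPart (Fp L) L (IsCMField.complexConj L) (n + n) (hermD L e dV hdV dW hdW) (𝒦.kPart (locToAdelic L e dV hdV dW hdW v.1 (y v)))))⁻¹)) := by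
    have h1 : placesEmbed L (hermD L e dV hdV dW hdW) T (yi * (UnitaryGroup.archPart (Fp L) L (IsCMField.complexConj L) (n + n) (hermD L e dV hdV dW hdW) (𝒦.kPart (UnitaryGroup.archToAdelic (Fp L) L (IsCMField.complexConj L) (n + n) (hermD L e dV hdV dW hdW) yi)))⁻¹,
        fun v : T => y v * (UnitaryGroup.evalPlace (Fp L) L (IsCMField.complexConj L) (n + n) (hermD L e dV hdV dW hdW) v.1 (UnitaryGroup.finPart (Fp L) L (IsCMField.complexConj L) (n + n) (hermD L e dV hdV dW hdW) (𝒦.kPart (locToAdelic L e dV hdV dW hdW v.1 (y v)))))⁻¹) =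
        placesEmbed L (hermD L e dV hdV dW hdW) T (yi * (UnitaryGroup.archPart (Fp L) L (IsCMField.complexConj L) (n + n) (hermD L e dV hdV dW hdW) (𝒦.kPart (UnitaryGroup.archToAdelic (Fp L) L (IsCMField.complexConj L) (n + n) (hermD L e dV hdV dW hdW) yi)))⁻¹, 1) *
          placesEmbed L (hermD L e dV hdV dW hdW) T (1, fun v : T => y v * (UnitaryGroup.evalPlace (Fp L) L (IsCMField.complexConj L) (n + n) (hermD L e dV hdV dW hdW) v.1 (UnitaryGroup.finPart (Fp L) L (IsCMField.complexConj L) (n + n) (hermD L e dV hdV dW hdW) (𝒦.kPart (locToAdelic L e dV hdV dW hdW v.1 (y v)))))⁻¹) := by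
      rw [← map_mul, Prod.mk_mul_mk, mul_one, one_mul]
    rw [h1, placesEmbed_fst_one_eq_archToAdelic]
    exact isSiegelDelta_mul L e dV hdV dW hdW haΔ (isSiegelDelta_placesEmbed_one L e dV hdV dW hdW T _ hwΔ)
  -- the componentwise-in-`K` quotients `κ = r⁻¹ x`
  have hκx : (placesEmbed L (hermD L e dV hdV dW hdW) T (yi * (UnitaryGroup.archPart (Fp L) L (IsCMField.complexConj L) (n + n) (hermD L e dV hdV dW hdW) (𝒦.kPart (UnitaryGroup.archToAdelic (Fp L) L (IsCMField.complexConj L) (n + n) (hermD L e dV hdV dW hdW) yi)))⁻¹,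
      fun v : T => y v * (UnitaryGroup.evalPlace (Fp L) L (IsCMField.complexConj L) (n + n) (hermD L e dV hdV dW hdW) v.1 (UnitaryGroup.finPart (Fp L) L (IsCMField.complexConj L) (n + n) (hermD L e dV hdV dW hdW) (𝒦.kPart (locToAdelic L e dV hdV dW hdW v.1 (y v)))))⁻¹))⁻¹ * placesEmbed L (hermD L e dV hdV dW hdW) T (yi, y) =
      placesEmbed L (hermD L e dV hdV dW hdW) T (UnitaryGroup.archPart (Fp L) L (IsCMField.complexConj L) (n + n) (hermD L e dV hdV dW hdW) (𝒦.kPart (UnitaryGroup.archToAdelic (Fp L) L (IsCMField.complexConj L) (n + n) (hermD L e dV hdV dW hdW) yi)), fun v : T => UnitaryGroup.evalPlace (Fp L) L (IsCMField.complexConj L) (n + n) (hermD L e dV hdV dW hdW) v.1 (UnitaryGroup.finPart (Fp L) L (IsCMField.complexConj L) (n + n) (hermD L e dV hdV dW hdW) (𝒦.kPart (locToAdelic L e dV hdV dW hdW v.1 (y v))))) := by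
    rw [← map_inv, ← map_mul, Prod.inv_mk, Prod.mk_mul_mk, mul_inv_rev, inv_inv, mul_assoc, inv_mul_cancel, mul_one]
    congr 1
    refine Prod.ext rfl (funext fun v => ?_)
    simp only [Pi.inv_apply, Pi.mul_apply, mul_inv_rev, inv_inv, mul_assoc, inv_mul_cancel, mul_one]
  have hκa : (UnitaryGroup.archToAdelic (Fp L) L (IsCMField.complexConj L) (n + n) (hermD L e dV hdV dW hdW) (yi * (UnitaryGroup.archPart (Fp L) L (IsCMField.complexConj L) (n + n) (hermD L e dV hdV dW hdW) (𝒦.kPart (UnitaryGroup.archToAdelic (Fp L) L (IsCMField.complexConj L) (n + n) (hermD L e dV hdV dW hdW) yi)))⁻¹))⁻¹ * UnitaryGroup.archToAdelic (Fp L) L (IsCMField.complexConj L) (n + n) (hermD L e dV hdV dW hdW) yi = UnitaryGroup.archToAdelic (Fp L) L (IsCMField.complexConj L) (n + n) (hermD L e dV hdV dW hdW) (UnitaryGroup.archPart (Fp L) L (IsCMField.complexConj L) (n + n) (hermD L e dV hdV dW hdW) (𝒦.kPart (UnitaryGroup.archToAdelic (Fp L) L (IsCMField.complexConj L) (n + n)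 (hermD L e dV hdV dW hdW) yi))) := by
    rw [← map_inv, ← map_mul, mul_inv_rev, inv_inv, mul_assoc, inv_mul_cancel, mul_one]
  have hκv : ∀ v : T, (locToAdelic L e dV hdV dW hdW v.1 (y v * (UnitaryGroup.evalPlace (Fp L) L (IsCMField.complexConj L) (n + n) (hermD L e dV hdV dW hdW) v.1 (UnitaryGroup.finPart (Fp L) L (IsCMField.complexConj L) (n + n) (hermD L e dV hdV dW hdW) (𝒦.kPart (locToAdelic L e dV hdV dW hdW v.1 (y v)))))⁻¹))⁻¹ *
      locToAdelic L e dV hdV dW hdW v.1 (y v) = locToAdelic L e dV hdV dW hdW v.1 (UnitaryGroup.evalPlace (Fp L) L (IsCMField.complexConj L) (n + n) (hermD L e dV hdV dW hdW) v.1 (UnitaryGroup.finPart (Fp L) L (IsCMField.complexConj L) (n + n) (hermD L e dV hdV dW hdW) (𝒦.kPart (locToAdelic L e dV hdV dW hdW v.1 (y v))))) := fun v => by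
    rw [← map_inv, ← map_mul, mul_inv_rev, inv_inv, mul_assoc, inv_mul_cancel, mul_one]
  -- (1) the slice element
  have hx := modDelta_pPart_eq_of_componentwise L e dV hdV hdV0 dW hdW hdW0 T h𝒦 hKT (placesEmbed L (hermD L e dV hdV dW hdW) T (yi, y)) _ _ hrΔ hκx
    ⟨𝒦.kPart (UnitaryGroup.archToAdelic (Fp L) L (IsCMField.complexConj L) (n + n) (hermD L e dV hdV dW hdW) yi), hka, by rw [archPart_placesEmbed]⟩
    (fun v hv => ⟨𝒦.kPart (locToAdelic L e dV hdV dW hdW v (y ⟨v, hv⟩)), hkv ⟨v, hv⟩, by rw [evalPlace_finPart_placesEmbed_of_mem L e dV hdV dW hdW T _ _ v hv]⟩)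
    (fun v hv => by rw [evalPlace_finPart_placesEmbed_of_not_mem L e dV hdV dW hdW T _ _ v hv]; exact one_mem _)
  -- (2) the archimedean factor alone
  have ha := modDelta_pPart_eq_of_componentwise L e dV hdV hdV0 dW hdW hdW0 T h𝒦 hKT (UnitaryGroup.archToAdelic (Fp L) L (IsCMField.complexConj L) (n + n) (hermD L e dV hdV dW hdW) yi) _ _ haΔ hκa
    ⟨𝒦.kPart (UnitaryGroup.archToAdelic (Fp L) L (IsCMField.complexConj L) (n + n) (hermD L e dV hdV dW hdW) yi), hka, by rw [archPart_archToAdelic]⟩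
    (fun v _ => ⟨1, 𝒦.K.one_mem, by rw [finPart_archToAdelic, finPart_one']⟩)
    (fun v _ => by rw [finPart_archToAdelic, map_one]; exact one_mem _)
  -- (3) each finite factor alone
  have hz : ∀ v : T, modDelta L e dV hdV dW hdW (𝒦.pPart (locToAdelic L e dV hdV dW hdW v.1 (y v))) =
      modDelta L e dV hdV dW hdW (locToAdelic L e dV hdV dW hdW v.1 (y v * (UnitaryGroup.evalPlace (Fp L) L (IsCMField.complexConj L) (n + n) (hermD L e dV hdV dW hdW) v.1 (UnitaryGroup.finPart (Fp L) L (IsCMField.complexConj L) (n + n) (hermD L e dV hdV dW hdW) (𝒦.kPart (locToAdelic L e dV hdV dW hdW v.1 (y v)))))⁻¹)) := fun v =>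
    modDelta_pPart_eq_of_componentwise L e dV hdV hdV0 dW hdW hdW0 T h𝒦 hKT _ _ _ ((mem_siegelDeltaLoc_iff L e dV hdV dW hdW v.1 _).1 (hwΔ v)) (hκv v)
      ⟨1, 𝒦.K.one_mem, by rw [archPart_locToAdelic, archPart_one']⟩
      (fun u hu => by
        by_cases huv : u = v.1
        · subst huv
          exact ⟨𝒦.kPart (locToAdelic L e dV hdV dW hdW v.1 (y v)), hkv v, by rw [evalPlace_finPart_locToAdelic_self]⟩
        · exact ⟨1, 𝒦.K.one_mem, by rw [evalPlace_finPart_locToAdelic_of_ne L e dV hdV dW hdW huv, finPart_one', map_one]⟩)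
      (fun u hu => by
        have huv : u ≠ v.1 := fun h => hu (h ▸ v.2)
        rw [evalPlace_finPart_locToAdelic_of_ne L e dV hdV dW hdW huv]; exact one_mem _)
  -- (4) the modulus of the componentwise `P`-part splits over the places (★ `split_of_isSiegelDelta_placesEmbed` at the trivial character, `2s + n = 1`)
  obtain ⟨-, -, hδ⟩ := split_of_isSiegelDelta_placesEmbed L e dV hdV dW hdW T (1 : HeckeCharacter L) ((1 - (n : ℂ)) / 2) _ _ hrΔ
  simp only [siegelCharLoc_apply, ← coe_modDelta_eq_siegelDeltaCharacter_one, ← Complex.ofReal_prod, ← Complex.ofReal_mul] at hδ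
  rw [hx, ha, Finset.prod_congr rfl fun v _ => hz v]
  exact_mod_cast hδ

end Summit.HodgeConjecture.HodgeConjecture.Cruxes.HLiu418.K2LiuIwasawaHeightPlaceFactorisation

end
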